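import Summits.AtomisticToContinuum.Crystallization.Theorems.FreeSplittingCertificatesRadiusLadderCompactness
import Summits.AtomisticToContinuum.Crystallization.Theorems.FreeSplittingCertificatesRadiusLadderRecurrence

/-!
# Free splitting certificates — the radius ladder on `ℚ³`, I: margins, rule transport, rational perturbation
(route `FreeSplittingCertificates`, crux r2 `FiniteRangeSplitting`, stmt-AtomisticToContinuum-12559)

VALUE = structural lemmas for a theorem about the crux (part II, `…RadiusLadderRationalCrux`: every non-rung of
the radius ladder is refuted by a finite zoo of RATIONAL configurations, so crux r2 is a statement about finite
subsets of `ℚ³`) — NOT summit progress.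

A refuting zoo of the LP falsifier (`exists_zoo_of_not_rungAt`) MUST realise some key at two different bonds
(`exists_recurrence_of_not_rungAt`); a generic perturbation of its points destroys the recurrences and with them
the refutation.  But recurrences are systems of coincidences `x_l - x_i = x'_l' - x'_i'` of bond vectors, i.e.
`ℤ`-linear relations among coordinates, and these survive any perturbation preserving the `ℚ`-linear relations
among the coordinates of the zoo:

* `exists_rat_specialization` : finitely many reals `c_k` have rational `η`-approximations `c'_k` satisfying
  every `ℚ`-linear relation `∑ l_k c_k = 0` the `c_k` satisfy (specialise a `ℚ`-basis of `span_ℚ {c_k} ⊆ ℝ` to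
  nearby rationals and extend linearly);
* `exists_margin_of_refuting` : a finite refuting zoo refutes with a margin `ε > 0` (compact rule space);
* `zkey_transport`, `exists_rule_of_perturbed` : a perturbation preserving pattern memberships and coincidences
  of bond vectors preserves coincidences of realised keys, and then every rule read on the perturbed zoo pulls
  back to a rule on the zoo whose site rows move by at most the total change of the bond energies;
* `exists_rat_perturbation` : at a radius avoiding its distances, a finite zoo of injective configurations has
  RATIONAL perturbations preserving memberships and coincidences, `δ'`-separated for any `δ' <` its hard core,
  with the bond energies at each site moved by `≤ ε` in total (`η = 1/(n+1)`, `n → ∞`).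
-/

noncomputable section

open scoped BigOperators Classical
open Filter Topology
open Literature.MathematicalPhysics.StatisticalMechanics

namespace Summit.AtomisticToContinuum.Crystallization.Theorems.StrictSplittingRuleBirth

/-- Euclidean `3`-space. -/
local notation "E3" => EuclideanSpace ℝ (Fin 3)

/-! ## 1. Rational specialisation of finitely many reals -/

/-- **Rational specialisation.**  Finitely many real numbers `c k` admit rational numbers `c' k`, each within
`η` of `c k`, satisfying EVERY `ℚ`-linear relation the `c k` satisfy: specialise a `ℚ`-basis of
`span_ℚ {c k} ⊆ ℝ` to nearby rationals and extend `ℚ`-linearly. [folklore] -/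
theorem exists_rat_specialization {K : Type*} [Fintype K] (c : K → ℝ) {η : ℝ} (hη : 0 < η) :
    ∃ c' : K → ℚ, (∀ k, |c k - (c' k : ℝ)| < η) ∧
      ∀ l : K → ℚ, ∑ k, (l k : ℝ) * c k = 0 → ∑ k, (l k : ℝ) * (c' k : ℝ) = 0 := by
  classical
  let W : Submodule ℚ ℝ := Submodule.span ℚ (Set.range c)
  haveI : FiniteDimensional ℚ W := FiniteDimensional.span_of_finite ℚ (Set.finite_range c)
  let B := Module.finBasis ℚ W
  have hc : ∀ k, c k ∈ W := fun k => Submodule.subset_span ⟨k, rfl⟩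
  let w : K → W := fun k => ⟨c k, hc k⟩
  let a : K → Fin (Module.finrank ℚ W) → ℚ := fun k m => B.equivFun (w k) m
  let S : ℝ := ∑ k, ∑ m, |(a k m : ℝ)| + 1
  have hS : 0 < S := by positivity
  have hηS : 0 < η / S := div_pos hη hS
  have hq : ∀ m : Fin (Module.finrank ℚ W), ∃ q : ℚ, |((B m : W) : ℝ) - q| < η / S := fun m => by
    obtain ⟨q, hq1, hq2⟩ :=
      exists_rat_btwn (show ((B m : W) : ℝ) - η / S < ((B m : W) : ℝ) + η / S by linarith)
    exact ⟨q, by rw [abs_lt]; constructor <;> linarith⟩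
  choose q hq using hq
  -- the ℚ-linear specialisation map
  let g : W →ₗ[ℚ] ℝ := B.constr ℚ fun m => (q m : ℝ)
  have hg : ∀ k, g (w k) = ∑ m, (a k m : ℝ) * q m := fun k => by
    simp only [g, Module.Basis.constr_apply_fintype, Rat.smul_def, a]
  have hck : ∀ k, c k = ∑ m, (a k m : ℝ) * ((B m : W) : ℝ) := fun k => by
    have h1 := congrArg (fun z : W => (z : ℝ)) (B.sum_equivFun (w k))
    simp only [Submodule.coe_sum, Submodule.coe_smul, Rat.smul_def] at h1
    exact h1.symm
  refine ⟨fun k => ∑ m, a k m * q m, fun k => ?_, fun l hl => ?_⟩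
  · have hT : ∑ m, |(a k m : ℝ)| < S := by
      have h1 : ∑ m, |(a k m : ℝ)| ≤ ∑ k', ∑ m, |(a k' m : ℝ)| :=
        Finset.single_le_sum (f := fun k' => ∑ m, |(a k' m : ℝ)|) (fun k' _ => by positivity)
          (Finset.mem_univ k)
      linarith
    have hdiff : c k - ((∑ m, a k m * q m : ℚ) : ℝ) = ∑ m, (a k m : ℝ) * (((B m : W) : ℝ) - q m) := by
      rw [hck k]
      push_cast
      rw [← Finset.sum_sub_distrib]
      refine Finset.sum_congr rfl fun m _ => by ring
    rw [hdiff]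
    calc |∑ m, (a k m : ℝ) * (((B m : W) : ℝ) - q m)|
        ≤ ∑ m, |(a k m : ℝ) * (((B m : W) : ℝ) - q m)| := Finset.abs_sum_le_sum_abs _ _
      _ ≤ ∑ m, |(a k m : ℝ)| * (η / S) := Finset.sum_le_sum fun m _ => by
          rw [abs_mul]
          exact mul_le_mul_of_nonneg_left (hq m).le (abs_nonneg _)
      _ = (∑ m, |(a k m : ℝ)|) * (η / S) := (Finset.sum_mul _ _ _).symm
      _ < S * (η / S) := mul_lt_mul_of_pos_right hT hηS
      _ = η := mul_div_cancel₀ η hS.ne'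
  · -- the relation holds in `W`, apply `g`
    have hW : ∑ k, l k • w k = 0 := by
      apply Subtype.ext
      have h1 : ((∑ k, l k • w k : W) : ℝ) = ∑ k, (l k : ℝ) * c k := by
        simp only [Submodule.coe_sum, Submodule.coe_smul, Rat.smul_def, w]
      rw [h1, hl]
      rfl
    have h2 := congrArg g hW
    rw [map_sum, map_zero] at h2
    simp only [map_smul, Rat.smul_def, hg] at h2
    push_cast
    exact h2

/-! ## 2. A refuting zoo refutes with a margin -/

/-- **Margin.**  If no rule is feasible on the finite zoo `Z` at radius `R`, then some `ε > 0` works uniformly: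
every rule has a site row `< e_∞ - ε` on `Z` (the sets of rules with all rows `≥ e_∞ - 1/(n+1)` on `Z` are
nested compacts in `[0,1]^(E3 × Finset E3)`; a common point would be feasible on `Z`). -/
theorem exists_margin_of_refuting (R : ℝ) (Z : Finset Conf)
    (href : ∀ Φ : E3 → Finset E3 → ℝ, IsRule Φ → ∃ c ∈ Z, ∃ i : Fin c.1, siteE R Φ c.2 i < eInf) :
    ∃ ε : ℝ, 0 < ε ∧
      ∀ Φ : E3 → Finset E3 → ℝ, IsRule Φ → ∃ c ∈ Z, ∃ i : Fin c.1, siteE R Φ c.2 i < eInf - ε := by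
  by_contra hne
  push Not at hne
  let t : ℕ → Set (E3 → Finset E3 → ℝ) := fun n =>
    {Φ | IsRule Φ} ∩ {Φ | ∀ c ∈ Z, ∀ i : Fin c.1, eInf - 1 / ((n : ℝ) + 1) ≤ siteE R Φ c.2 i}
  have hcl : ∀ η : ℝ,
      IsClosed {Φ : E3 → Finset E3 → ℝ | ∀ c ∈ Z, ∀ i : Fin c.1, eInf - η ≤ siteE R Φ c.2 i} := by
    intro η
    have h : {Φ : E3 → Finset E3 → ℝ | ∀ c ∈ Z, ∀ i : Fin c.1, eInf - η ≤ siteE R Φ c.2 i} =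
        ⋂ c : Conf, ⋂ (_ : c ∈ Z), ⋂ i : Fin c.1, {Φ | eInf - η ≤ siteE R Φ c.2 i} := by
      ext Φ
      simp only [Set.mem_setOf_eq, Set.mem_iInter]
    rw [h]
    exact isClosed_iInter fun c => isClosed_iInter fun _ => isClosed_iInter fun i =>
      isClosed_le continuous_const (continuous_siteE R c.2 i)
  have htd : ∀ n, t (n + 1) ⊆ t n := by
    intro n Φ hΦ
    refine ⟨hΦ.1, fun c hc i => ?_⟩
    have h2 := hΦ.2 c hc i
    have hle : 1 / ((n : ℝ) + 1 + 1) ≤ 1 / ((n : ℝ) + 1) :=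
      one_div_le_one_div_of_le (by positivity) (by linarith)
    push_cast at h2
    linarith
  have htn : ∀ n, (t n).Nonempty := fun n => by
    obtain ⟨Φ, hr, hf⟩ := hne (1 / ((n : ℝ) + 1)) (by positivity)
    exact ⟨Φ, hr, hf⟩
  have htcl : ∀ n, IsClosed (t n) := fun n => isClosed_setOf_isRule.inter (hcl _)
  have ht0 : IsCompact (t 0) := isCompact_ruleBox.of_isClosed_subset (htcl 0) fun _ h => h.1.1
  obtain ⟨Φ, hΦ⟩ := IsCompact.nonempty_iInter_of_sequence_nonempty_isCompact_isClosed t htd htn ht0 htcl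
  have hmem : ∀ n, Φ ∈ t n := Set.mem_iInter.1 hΦ
  obtain ⟨c, hc, i, hlt⟩ := href Φ (hmem 0).1
  obtain ⟨n, hn⟩ := exists_nat_one_div_lt (show 0 < eInf - siteE R Φ c.2 i by linarith)
  have h2 := (hmem n).2 c hc i
  linarith

/-! ## 3. Transport of a rule along a key-preserving perturbation -/

/-- **Key transport.**  If a perturbation `y` of the configurations of `Z` preserves every pattern membership at
radius `R` and every coincidence of bond vectors across the zoo, then it preserves every coincidence of realised
keys: equal keys of `Z` stay equal after perturbation. -/
theorem zkey_transport (R : ℝ) (Z : Finset Conf) (y : (c : Conf) → Fin c.1 → E3)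
    (hmem : ∀ c ∈ Z, ∀ l i : Fin c.1, (dist (c.2 l) (c.2 i) ≤ R ↔ dist (y c l) (y c i) ≤ R))
    (hrel : ∀ c ∈ Z, ∀ c' ∈ Z, ∀ (i j : Fin c.1) (i' j' : Fin c'.1),
      c.2 j - c.2 i = c'.2 j' - c'.2 i' → y c j - y c i = y c' j' - y c' i')
    {b b' : Bond} (hb : b ∈ zbonds Z) (hb' : b' ∈ zbonds Z) (hk : zkey R b = zkey R b') :
    zkey R ⟨⟨b.1.1, y b.1⟩, b.2⟩ = zkey R ⟨⟨b'.1.1, y b'.1⟩, b'.2⟩ := by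
  obtain ⟨c, i, j⟩ := b
  obtain ⟨c', i', j'⟩ := b'
  have hc : c ∈ Z := (mem_zbonds.1 hb).1
  have hc' : c' ∈ Z := (mem_zbonds.1 hb').1
  simp only [zkey, Prod.mk.injEq] at hk ⊢
  obtain ⟨hv, hT⟩ := hk
  refine ⟨hrel c hc c' hc' i j i' j' hv, ?_⟩
  have hT' : ∀ w : E3, (∃ l, (dist (c.2 l) (c.2 i) ≤ R ∨ dist (c.2 l) (c.2 j) ≤ R) ∧ c.2 l - c.2 i = w) ↔
      (∃ l', (dist (c'.2 l') (c'.2 i') ≤ R ∨ dist (c'.2 l') (c'.2 j') ≤ R) ∧ c'.2 l' - c'.2 i' = w) := by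
    intro w
    simpa only [bondPattern, Finset.mem_image, Finset.mem_filter, Finset.mem_univ, true_and] using
      Finset.ext_iff.1 hT w
  ext w
  simp only [bondPattern, Finset.mem_image, Finset.mem_filter, Finset.mem_univ, true_and]
  constructor
  · rintro ⟨l, hl, hlw⟩
    obtain ⟨l', hl', he⟩ :=
      (hT' (c.2 l - c.2 i)).1 ⟨l, hl.imp (hmem c hc l i).2 (hmem c hc l j).2, rfl⟩
    refine ⟨l', hl'.imp (hmem c' hc' l' i').1 (hmem c' hc' l' j').1, ?_⟩
    rw [← hlw]
    exact hrel c' hc' c hc i' l' i l he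
  · rintro ⟨l', hl', hlw⟩
    obtain ⟨l, hl, he⟩ :=
      (hT' (c'.2 l' - c'.2 i')).2 ⟨l', hl'.imp (hmem c' hc' l' i').2 (hmem c' hc' l' j').2, rfl⟩
    refine ⟨l, hl.imp (hmem c hc l i).1 (hmem c hc l j).1, ?_⟩
    rw [← hlw]
    exact hrel c hc c' hc' i l i' l' he

/-- **Rule transport.**  Let `y` perturb the (injective) configurations of `Z` so that equal realised keys stay
equal.  Then every rule `Φ` read on the perturbed configurations pulls back to a rule `Ψ` on `Z` whose site rows
are those of `Φ` up to the change of the bond energies: `Ψ` gives the bond `(c,i,j)` the weight `Φ` gives the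
perturbed bond (well defined by key preservation; complementary by `zkey_rev`). -/
theorem exists_rule_of_perturbed (R : ℝ) (Z : Finset Conf) (y : (c : Conf) → Fin c.1 → E3)
    (hinj : ∀ c ∈ Z, Function.Injective (y c))
    (hkey : ∀ b ∈ zbonds Z, ∀ b' ∈ zbonds Z, zkey R b = zkey R b' →
      zkey R ⟨⟨b.1.1, y b.1⟩, b.2⟩ = zkey R ⟨⟨b'.1.1, y b'.1⟩, b'.2⟩)
    {Φ : E3 → Finset E3 → ℝ} (hΦ : IsRule Φ) :
    ∃ Ψ : E3 → Finset E3 → ℝ, IsRule Ψ ∧ ∀ c ∈ Z, ∀ i : Fin c.1,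
      siteE R Φ (y c) i - ∑ j ∈ Finset.univ.erase i,
        |lennardJones (dist (c.2 i) (c.2 j)) - lennardJones (dist (y c i) (y c j))| ≤ siteE R Ψ c.2 i := by
  classical
  let yb : Bond → Bond := fun b => ⟨⟨b.1.1, y b.1⟩, b.2⟩
  let W : Bond → ℝ := fun b => Φ (zkey R (yb b)).1 (zkey R (yb b)).2
  have hWbox : ∀ b, 0 ≤ W b ∧ W b ≤ 1 := fun b => hΦ.1 _ _
  have hWrev : ∀ b ∈ zbonds Z, W b + W b.rev = 1 := by
    intro b hb
    obtain ⟨hc, hij⟩ := mem_zbonds.1 hb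
    have hne : (zkey R (yb b)).1 ≠ 0 := sub_ne_zero.2 fun h => hij ((hinj _ hc) h).symm
    have hk : zkey R (yb b.rev) = (zkey R (yb b)).conj := zkey_rev R (yb b)
    show Φ (zkey R (yb b)).1 (zkey R (yb b)).2 + Φ (zkey R (yb b.rev)).1 (zkey R (yb b.rev)).2 = 1
    rw [hk]
    exact hΦ.2 _ _ hne
  let Ψ : Key → ℝ := fun k => if h : ∃ b ∈ zbonds Z, zkey R b = k then W (Classical.choose h) else 1 / 2
  have hΨkey : ∀ b ∈ zbonds Z, Ψ (zkey R b) = W b := by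
    intro b hb
    have h : ∃ b' ∈ zbonds Z, zkey R b' = zkey R b := ⟨b, hb, rfl⟩
    simp only [Ψ, dif_pos h]
    obtain ⟨hb', hk⟩ := Classical.choose_spec h
    exact congrArg (fun k : Key => Φ k.1 k.2) (hkey _ hb' _ hb hk)
  have hΨfree : ∀ k : Key, (¬ ∃ b ∈ zbonds Z, zkey R b = k) → Ψ k = 1 / 2 := fun k hk => by
    simp only [Ψ, dif_neg hk]
  have hΨbox : ∀ k : Key, 0 ≤ Ψ k ∧ Ψ k ≤ 1 := by
    intro k
    by_cases h : ∃ b ∈ zbonds Z, zkey R b = k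
    · obtain ⟨b, hb, rfl⟩ := h
      rw [hΨkey b hb]
      exact hWbox b
    · rw [hΨfree k h]
      norm_num
  have hΨconj : ∀ k : Key, Ψ k + Ψ k.conj = 1 := by
    intro k
    by_cases h : ∃ b ∈ zbonds Z, zkey R b = k
    · obtain ⟨b, hb, rfl⟩ := h
      rw [← zkey_rev, hΨkey b hb, hΨkey b.rev (rev_mem_zbonds hb)]
      exact hWrev b hb
    · have h' : ¬ ∃ b ∈ zbonds Z, zkey R b = k.conj := by
        rintro ⟨b, hb, hk⟩
        refine h ⟨b.rev, rev_mem_zbonds hb, ?_⟩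
        rw [zkey_rev, hk, Key.conj_conj]
      rw [hΨfree k h, hΨfree _ h']
      norm_num
  refine ⟨fun v T => Ψ (v, T), ⟨fun v T => hΨbox (v, T), fun v T _ => hΨconj (v, T)⟩, ?_⟩
  intro c hc i
  rw [perturbative_siteE_eq, perturbative_siteE_eq]
  have hterm : ∀ j ∈ Finset.univ.erase i,
      Ψ (c.2 j - c.2 i, bondPattern R c.2 i j) * lennardJones (dist (c.2 i) (c.2 j)) =
        Φ (y c j - y c i) (bondPattern R (y c) i j) * lennardJones (dist (c.2 i) (c.2 j)) := by
    intro j hj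
    have hij : i ≠ j := (Finset.ne_of_mem_erase hj).symm
    have hb : (⟨c, (i, j)⟩ : Bond) ∈ zbonds Z := mem_zbonds.2 ⟨hc, hij⟩
    have hk := hΨkey _ hb
    simp only [zkey] at hk
    rw [hk]
    rfl
  rw [Finset.sum_congr rfl hterm, sub_le_iff_le_add, ← Finset.sum_add_distrib]
  refine Finset.sum_le_sum fun j _ => ?_
  have h01 := hΦ.1 (y c j - y c i) (bondPattern R (y c) i j)
  have h : Φ (y c j - y c i) (bondPattern R (y c) i j) * lennardJones (dist (y c i) (y c j)) -
      Φ (y c j - y c i) (bondPattern R (y c) i j) * lennardJones (dist (c.2 i) (c.2 j)) ≤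
        |lennardJones (dist (c.2 i) (c.2 j)) - lennardJones (dist (y c i) (y c j))| := by
    rw [← mul_sub, abs_sub_comm]
    calc Φ (y c j - y c i) (bondPattern R (y c) i j) *
          (lennardJones (dist (y c i) (y c j)) - lennardJones (dist (c.2 i) (c.2 j)))
        ≤ |Φ (y c j - y c i) (bondPattern R (y c) i j) *
          (lennardJones (dist (y c i) (y c j)) - lennardJones (dist (c.2 i) (c.2 j)))| := le_abs_self _
      _ ≤ 1 * |lennardJones (dist (y c i) (y c j)) - lennardJones (dist (c.2 i) (c.2 j))| := by
          rw [abs_mul, abs_of_nonneg h01.1]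
          exact mul_le_mul_of_nonneg_right h01.2 (abs_nonneg _)
      _ = _ := one_mul _
  linarith

/-! ## 4. Rational perturbation of a zoo -/

/-- A signed sum of four coordinates as a `ℚ`-linear form. -/
theorem sum_rel4 {K : Type*} [Fintype K] [DecidableEq K] (f : K → ℝ) (k₁ k₂ k₃ k₄ : K) :
    ∑ k, (((if k = k₁ then (1 : ℚ) else 0) - (if k = k₂ then 1 else 0) - (if k = k₃ then 1 else 0) +
      (if k = k₄ then 1 else 0) : ℚ) : ℝ) * f k = f k₁ - f k₂ - f k₃ + f k₄ := by
  simp only [Rat.cast_add, Rat.cast_sub, apply_ite ((↑) : ℚ → ℝ), Rat.cast_one, Rat.cast_zero, add_mul,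
    sub_mul, ite_mul, one_mul, zero_mul, Finset.sum_add_distrib, Finset.sum_sub_distrib,
    Finset.sum_ite_eq', Finset.mem_univ, if_true]

/-- **Rational perturbation.**  A finite zoo of injective configurations, none of whose distances equals `R`,
admits RATIONAL perturbations of its configurations that are `δ'`-separated (any `δ' <` the hard core of the
zoo), have the same pattern memberships at radius `R`, satisfy every coincidence of bond vectors the zoo
satisfies, and move the bond energies at each site by at most `ε` in total.  (Specialise all coordinates by
`exists_rat_specialization` with `η = 1/(n+1)` and let `n → ∞`: the strict conditions hold eventually, the
linear ones exactly.) -/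
theorem exists_rat_perturbation (Z : Finset Conf) (hZ : ∀ c ∈ Z, Function.Injective c.2) {R δ δ' ε : ℝ}
    (hgen : ∀ c ∈ Z, ∀ l i : Fin c.1, dist (c.2 l) (c.2 i) ≠ R) (hsep : ∀ c ∈ Z, Sep δ c.2) (hδ : δ' < δ)
    (hε : 0 < ε) :
    ∃ y : (c : Conf) → Fin c.1 → E3, (∀ c ∈ Z, ∀ (i : Fin c.1) (a : Fin 3), ∃ q : ℚ, y c i a = q) ∧
      (∀ c ∈ Z, Sep δ' (y c)) ∧
      (∀ c ∈ Z, ∀ l i : Fin c.1, (dist (c.2 l) (c.2 i) ≤ R ↔ dist (y c l) (y c i) ≤ R)) ∧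
      (∀ c ∈ Z, ∀ c' ∈ Z, ∀ (i j : Fin c.1) (i' j' : Fin c'.1),
        c.2 j - c.2 i = c'.2 j' - c'.2 i' → y c j - y c i = y c' j' - y c' i') ∧
      (∀ c ∈ Z, ∀ i : Fin c.1, ∑ j ∈ Finset.univ.erase i,
        |lennardJones (dist (c.2 i) (c.2 j)) - lennardJones (dist (y c i) (y c j))| ≤ ε) := by
  classical
  -- all coordinates of the zoo, and their rational specialisations at accuracy 1/(n+1)
  let K := Σ c : {c // c ∈ Z}, Fin c.1.1 × Fin 3
  let co : K → ℝ := fun k => k.1.1.2 k.2.1 k.2.2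
  choose C hCnear hCrel using
    fun n : ℕ => exists_rat_specialization co (η := 1 / ((n : ℝ) + 1)) (by positivity)
  let y : ℕ → (c : Conf) → Fin c.1 → E3 := fun n c i =>
    if h : c ∈ Z then WithLp.toLp 2 fun a => ((C n ⟨⟨c, h⟩, (i, a)⟩ : ℚ) : ℝ) else c.2 i
  have hy : ∀ n c (h : c ∈ Z) (i : Fin c.1) (a : Fin 3), y n c i a = C n ⟨⟨c, h⟩, (i, a)⟩ := by
    intro n c h i a
    have h1 : y n c i = WithLp.toLp 2 fun a => ((C n ⟨⟨c, h⟩, (i, a)⟩ : ℚ) : ℝ) := dif_pos h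
    rw [h1]
  -- convergence of points, distances and bond energies
  have htend : ∀ c (h : c ∈ Z) (i : Fin c.1), Tendsto (fun n => y n c i) atTop (𝓝 (c.2 i)) := by
    intro c h i
    have hco : ∀ a, Tendsto (fun n => y n c i a) atTop (𝓝 (c.2 i a)) := by
      intro a
      rw [Metric.tendsto_atTop]
      intro e he
      obtain ⟨m, hm⟩ := exists_nat_one_div_lt he
      refine ⟨m, fun n hn => ?_⟩
      rw [hy n c h i a, Real.dist_eq, abs_sub_comm]
      have h1 : |c.2 i a - C n ⟨⟨c, h⟩, (i, a)⟩| < 1 / ((n : ℝ) + 1) := hCnear n ⟨⟨c, h⟩, (i, a)⟩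
      have h2 : 1 / ((n : ℝ) + 1) ≤ 1 / ((m : ℝ) + 1) :=
        one_div_le_one_div_of_le (by positivity) (by exact_mod_cast Nat.add_le_add_right hn 1)
      linarith
    have h1 : Tendsto (fun n => WithLp.ofLp (y n c i)) atTop (𝓝 (WithLp.ofLp (c.2 i))) :=
      tendsto_pi_nhds.2 hco
    exact ((PiLp.continuous_toLp 2 (fun _ : Fin 3 => ℝ)).tendsto _).comp h1
  have hd : ∀ c (h : c ∈ Z) (i j : Fin c.1),
      Tendsto (fun n => dist (y n c i) (y n c j)) atTop (𝓝 (dist (c.2 i) (c.2 j))) :=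
    fun c h i j => (htend c h i).dist (htend c h j)
  have hV : ∀ c (h : c ∈ Z) (i j : Fin c.1), i ≠ j → Tendsto (fun n => lennardJones (dist (y n c i) (y n c j)))
      atTop (𝓝 (lennardJones (dist (c.2 i) (c.2 j)))) := fun c h i j hij =>
    ((continuousOn_lennardJones.continuousAt
      (isOpen_compl_singleton.mem_nhds (dist_ne_zero.2 ((hZ c h).ne hij)))).tendsto).comp (hd c h i j)
  -- the strict requirements hold eventually
  have hE1 : ∀ᶠ n in atTop, ∀ c ∈ Z, Sep δ' (y n c) := by
    refine (Filter.eventually_all_finset Z).2 fun c hc => ?_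
    refine Filter.eventually_all.2 fun i => Filter.eventually_all.2 fun j => ?_
    by_cases hij : i = j
    · exact Filter.Eventually.of_forall fun n h => absurd hij h
    · exact ((hd c hc i j).eventually_const_lt (hδ.trans_le (hsep c hc i j hij))).mono fun n hn _ => hn.le
  have hE2 : ∀ᶠ n in atTop, ∀ c ∈ Z, ∀ l i : Fin c.1,
      (dist (c.2 l) (c.2 i) ≤ R ↔ dist (y n c l) (y n c i) ≤ R) := by
    refine (Filter.eventually_all_finset Z).2 fun c hc => ?_
    refine Filter.eventually_all.2 fun l => Filter.eventually_all.2 fun i => ?_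
    rcases lt_or_gt_of_ne (hgen c hc l i) with hlt | hgt
    · exact ((hd c hc l i).eventually_lt_const hlt).mono fun n hn => iff_of_true hlt.le hn.le
    · exact ((hd c hc l i).eventually_const_lt hgt).mono fun n hn => iff_of_false (not_le.2 hgt) (not_le.2 hn)
  have hE3 : ∀ᶠ n in atTop, ∀ c ∈ Z, ∀ i : Fin c.1, ∑ j ∈ Finset.univ.erase i,
      |lennardJones (dist (c.2 i) (c.2 j)) - lennardJones (dist (y n c i) (y n c j))| < ε := by
    refine (Filter.eventually_all_finset Z).2 fun c hc => Filter.eventually_all.2 fun i => ?_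
    have h0 : Tendsto (fun n => ∑ j ∈ Finset.univ.erase i,
        |lennardJones (dist (c.2 i) (c.2 j)) - lennardJones (dist (y n c i) (y n c j))|) atTop
        (𝓝 (∑ j ∈ Finset.univ.erase i,
          |lennardJones (dist (c.2 i) (c.2 j)) - lennardJones (dist (c.2 i) (c.2 j))|)) := by
      refine tendsto_finsetSum _ fun j hj => ?_
      exact (continuous_abs.tendsto _).comp
        (tendsto_const_nhds.sub (hV c hc i j (Finset.ne_of_mem_erase hj).symm))
    simp only [sub_self, abs_zero, Finset.sum_const_zero] at h0
    exact h0.eventually_lt_const hε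
  obtain ⟨n, h1, h2, h3⟩ := (hE1.and (hE2.and hE3)).exists
  refine ⟨y n, fun c hc i a => ⟨_, hy n c hc i a⟩, h1, h2, ?_, fun c hc i => (h3 c hc i).le⟩
  -- the linear requirements hold exactly
  intro c hc c' hc' i j i' j' hrel
  refine PiLp.ext fun a => ?_
  have hco := congrArg (fun v : E3 => v a) hrel
  simp only [WithLp.ofLp_sub, Pi.sub_apply] at hco ⊢
  rw [hy n c hc j a, hy n c hc i a, hy n c' hc' j' a, hy n c' hc' i' a]
  have h := hCrel n (fun k => (if k = ⟨⟨c, hc⟩, (j, a)⟩ then 1 else 0) - (if k = ⟨⟨c, hc⟩, (i, a)⟩ then 1 else 0)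
    - (if k = ⟨⟨c', hc'⟩, (j', a)⟩ then 1 else 0) + (if k = ⟨⟨c', hc'⟩, (i', a)⟩ then 1 else 0))
    (by rw [sum_rel4]; show c.2 j a - c.2 i a - c'.2 j' a + c'.2 i' a = 0; linarith)
  rw [sum_rel4] at h
  linarith

end Summit.AtomisticToContinuum.Crystallization.Theorems.StrictSplittingRuleBirth

end
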